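import Literature.MathematicalPhysics.QuantumManyBody.PeriodicBoseGasLemma33
import Literature.MathematicalPhysics.QuantumManyBody.PeriodicBoseGasThm31
import Mathlib.Algebra.MvPolynomial.PDeriv
import Mathlib.RingTheory.MvPolynomial.Homogeneous
import HarnessLib

/-!
# Second quantisation for bosons on the torus: the Fock layer over plane waves

Topic `Literature/MathematicalPhysics/QuantumManyBody` (definition item `defn-TorusBoseFockLayer`,
companion of `PeriodicBoseGas.lean` / `PeriodicBoseGasFourier.lean`; wanted by route
BECRichardsonAnchor, items stmt-AtomisticToContinuum-5827 `RichardsonAnchorBEC` and -5826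
`BeliaevDeformationBEC`, whose anchor Hamiltonian
`H_R = Σ_k (k² + Δ[k ≠ 0]) a†_k a_k + (γ/2V) Σ_{k,k' ∈ B_Λ} a†_k a†_{-k} a_{-k'} a_{k'}` is Richardson's
exactly solvable repulsive `su(1,1)` boson pairing model [Richardson1968; DukelskySchuck2001, (1);
DukelskyPittelSierra2004, §II–III]).

The file has three layers.

**A. The bosonic Fock layer over an arbitrary set of modes `ι`** (namespace `…BoseGas.Fock`), in the
holomorphic (Bargmann–Segal, "symmetric algebra") model: the finite-excitation Fock space is the
polynomial algebra `MvPolynomial ι ℂ`; the occupation-number vector `|d⟩⟩ = Π_i (a†_i)^{d_i}|0⟩`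
(`d : ι →₀ ℕ`, unnormalised, `‖|d⟩⟩‖² = d! = Π_i d_i!`) is the monomial `X^d`, the vacuum is `1`,
`a†_i` is multiplication by `X_i` (`Fock.cr`) and `a_i = ∂/∂X_i` (`Fock.an`, Mathlib's
`MvPolynomial.pderiv`). This is literally the isomorphism (A.9) of [LSSY2005, App. A]:
`Ψ = Σ_{k_1…k_N} φ(k_1,…,k_N) a†_{k_1}⋯a†_{k_N}|0⟩` with `φ` symmetric is the polynomial
`Σ φ(k_1,…,k_N) X_{k_1}⋯X_{k_N}`. We prove the CCR `[a_i, a†_j] = δ_ij`, `[a_i,a_j] = [a†_i,a†_j] = 0`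
[LSSY2005, (A.7)], `a_i|0⟩ = 0` (A.8), the number operators `n_i = a†_i a_i` with `n_i X^d = d_i X^d`,
the `N`-particle sector = homogeneous polynomials of degree `N` (Mathlib's `IsHomogeneous`,
`homogeneousSubmodule`) with `a† : N → N+1`, `a : N → N-1`, `a†a, a†a†aa : N → N` (number
conservation, (A.11)), the Bargmann inner product `⟨p,q⟩ = Σ_d d! conj(p_d) q_d` (`fockInner`, for
which `a†_i` is adjoint to `a_i`: `fockInner_cr_left`), the momentum-pair operators `a_{-k}a_k`,
`a†_k a†_{-k}`, `P_B = Σ_{k∈B} a_{-k}a_k` over an additive group of modes, and the `su(1,1)` pair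
algebra in the normalisation of [DukelskyPittelSierra2004, eq. (KB), p. 8 of arXiv:nucl-th/0405011;
DukelskySchuck2001, p. 3]: for the time-reversal level `{k,-k}`,
`K⁺_k = ½ Σ_{m∈{k,-k}} a†_m a†_{-m}` (`= a†_k a†_{-k}` for `k ≠ -k`, `= ½ a†_0²` for `k = 0`),
`K⁻_k = (K⁺_k)†`, `K⁰_k = ½ Σ_{m∈{k,-k}} n_m + ¼ #{k,-k}` (`= ½(n_k+n_{-k}+1)`, resp. `(2n_0+1)/4`),
with `[K⁻_k, K⁺_k] = 2K⁰_k` (`kMinus_kPlus_sub`; the raw forms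
`[a_{-k}a_k, a†_ka†_{-k}] = n_k + n_{-k} + 1`, `[a², a†²] = 4n + 2` are `pairAn_pairCr_sub`,
`an_an_cr_cr_sub`).

**B. The torus of side `L`** (namespace `…BoseGas`): modes `n ∈ ℤ³ = Momentum` with wave vector
`k = 2πn/L` (`waveVector`, `‖k‖² = 4π²|n|²/L²`), the normalised plane waves
`φ_n = L^{-3/2} e^{2πi n·x/L} 1_cell` (`planeWave`, built on `cellWave` of
`PeriodicBoseGasFourier.lean` (orthogonality `cellFourierCoeff_cellWave` from `PeriodicBoseGasLemma33.lean`);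
orthonormal in `L²`: `integral_conj_planeWave_mul_planeWave`,
`lintegral_nnnorm_sq_planeWave`; `φ_0 = constantMode`), the **momentum occupation**
`n_k(Ψ) = ⟨φ_n, γ_Ψ φ_n⟩ = ⟨Ψ, a†_k a_k Ψ⟩`
(`momentumOccupation N L n Ψ := cellOccupation N L (planeWave L n) Ψ`;
`n_0 = condensateOccupation`, `momentumOccupation_zero`), the band `B_M = {-M..M}³`
(`momentumBand`; the route's `B_Λ`, `M = ⌊ΛL/2π⌋`) with its kernel
`w(x,y) = Σ_{m∈B_M} e^{2πi m·(x-y)/L}` (`bandKernel`, *verbatim* the route's `w`, `bandKernel_eq`)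
and the identity `Σ_{k∈B_M} φ_k(x)φ_{-k}(y) = L⁻³ w(x,y)` on the cell, the first-quantised band pair
annihilation
`(P_B Ψ)(Y) = (Σ_{k∈B} a_{-k}a_k Ψ)(Y) = √(N(N-1)) ∫∫ conj(Σ_{k∈B} φ_k(x)φ_{-k}(y)) Ψ(x,y,Y) dx dy`
(`bandPairAnnihilation`; [LSSY2005, (A.13)] applied twice, in the `L²`-normalised convention
`(a(φ)Ψ)(X') = √N ∫ conj(φ(x)) Ψ(x,X') dx`), and the **dictionary lemma for the route's pair
term**: `(N(N-1)/2) ∫_{cell^{N-2}} |∫∫ conj(w(x,y)) Ψ(x,y,Y) dx dy|² dY = (L⁶/2) ‖P_{B_M}Ψ‖²`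
(`pairFunctional_eq`), i.e. the anchor interaction `(γ/L⁹)·(…)` equals `(γ/2L³) ⟨Ψ, P†PΨ⟩`.
Finally `TorusBoseFockLayer := MvPolynomial Momentum ℂ` is the torus instance of layer A, on
which `Fock.cr`, `Fock.an`, `Fock.numberOp`, `Fock.bandPairAn (momentumBand M)`, `Fock.kPlus` …
act.

**C. The dictionary for `N`-body states** (the first-quantised meaning of `⟨Ψ, a†_k a_k Ψ⟩`,
`Σ_k a†_k a_k = N` and `Σ_k ε(k) a†_k a_k`; slice/Fubini toolkit of `PeriodicBoseGasThm31.lean`):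
`n_k(Ψ) = N L³ ∫_{cell^{N-1}} |ĉ_k(Ψ(·,Y))|² dY` (`momentumOccupation_succ`), the `N`-body
**Parseval** `Σ_k n_k(Ψ) = N ∫_{cell^N}|Ψ|²` for continuous `Ψ` (`tsum_momentumOccupation`; `= N`
for a periodic trial state, `tsum_momentumOccupation_trialState`), the **depletion identity**
`N - condensateOccupation = Σ_{k≠0} n_k` (`natCast_sub_condensateOccupation`; the route's penalty
term `2ργ(N - n₀)` is the exchange shift `Δ Σ_{k≠0} a†_k a_k`), and the **kinetic identity**
`∫_{cell^N} |∇Ψ|² = Σ_k |k|² n_k(Ψ)` for periodic `C¹` Bose-symmetric states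
(`tsum_normSq_waveVector_mul_momentumOccupation`; `periodicEnergy 0 Ψ = Σ_k |k|² n_k(Ψ)`,
`periodicEnergy_zero_eq_tsum`) — so all three terms of the route's anchor functional `E_R` are
expectations of `H_R = Σ_k (k²+Δ[k≠0]) a†_k a_k + (γ/2V) P_B† P_B`.

## What is deliberately NOT here

* The isomorphism (A.9) between `C¹` periodic `N`-body functions and Fock vectors as a map: a
  general `Ψ` has infinitely many non-zero momentum amplitudes and lives in the Hilbert completion
  of `MvPolynomial Momentum ℂ`, not in it; the route needs the operator algebra (layer A) and the
  first-quantised expectations (layer B), which are stated directly on `Ψ : Config N → ℂ`.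
* Richardson's equations, Bethe states and the Gaudin algebra (layer-2 material of the route).
* Mathlib has no bosonic Fock space / CCR algebra (searched `Fock`, `CCR`, `boson`,
  `annihilation`: only `CliffordAlgebra`, free algebras); `MvPolynomial.pderiv`, `IsHomogeneous`,
  `UnitAddTorus.mFourier` are Mathlib's.

## References

* [LSSY2005] E. H. Lieb, R. Seiringer, J. P. Solovej, J. Yngvason, *The Mathematics of the Bose Gas
  and its Condensation*, Birkhäuser 2005 (arXiv:cond-mat/0610117), Appendix A "Elements of
  Bogoliubov Theory": (A.3) the momenta `(2π/L)ℤ³`, (A.5) momentum representation, (A.7) CCR,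
  (A.8) vacuum, (A.9) the isomorphism `φ ↦ Σ φ a†⋯a†|0⟩`, (A.10) `H`, (A.11) number operator,
  (A.13)–(A.14) configuration-space action of `a_k`, `a†_k`, (A.15) `ρ(k)`.
* [DukelskyPittelSierra2004] J. Dukelsky, S. Pittel, G. Sierra, *Colloquium: Exactly solvable
  Richardson–Gaudin models for many-body quantum systems*, Rev. Mod. Phys. 76 (2004) 643,
  arXiv:nucl-th/0405011: §II.1 (Richardson's model), §III eq. (KB) (boson pair operators
  `K⁰_l = ½Σ_m a†a + ¼Ω_l`, `K⁺_l = ½Σ_m a†_{lm}a†_{l m̄} = (K⁻_l)†`) and the `SU(1,1)` relations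
  `[K⁰_l, K^±_l'] = ±δ K^±_l`, `[K⁺_l, K⁻_l'] = -2δ K⁰_l`.
* [DukelskySchuck2001] J. Dukelsky, P. Schuck, *Condensate fragmentation in a new exactly solvable
  model for confined bosons*, Phys. Rev. Lett. 86 (2001) 4207, arXiv:cond-mat/0009057: eq. (1)
  `H_P = Σ ε_Λ n_Λ + (g/2) Σ A†_Λ A_Λ'`, `A_Λ = Σ_α a_{Λᾱ} a_{Λα}`; p. 3 `K⁰ = ½n + ¼Ω`, `K⁺ = ½A†`.
* [Richardson1968] R. W. Richardson, *Exactly Solvable Many-Boson Model*, J. Math. Phys. 9 (1968)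
  1327 (the model; its statement is taken here from the two secondary sources above).
* [Fournais2020] S. Fournais, *Length scales for BEC in the dilute Bose gas*, arXiv:2011.00309:
  (1.3)–(1.5) (`P_Ω`, `n₀`, `n₊`).
-/

noncomputable section


namespace Literature.MathematicalPhysics.QuantumManyBody.BoseGas

open MeasureTheory Complex WithLp MvPolynomial
open scoped ENNReal NNReal ComplexConjugate

/-! ## A. The bosonic Fock layer over a set of modes `ι` (holomorphic model) -/

namespace Fock

variable {ι : Type*}

/-! ### Creation and annihilation operators, CCR -/

/-- The **creation operator** `a†ᵢ` on the finite-excitation Fock space `MvPolynomial ι ℂ`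
(holomorphic model: `|d⟩⟩ = X^d`): multiplication by `Xᵢ`, so `a†ᵢ X^d = X^{d+eᵢ}`.
[cite: LSSY2005, App. A (A.7)–(A.9)] -/
def cr (i : ι) : MvPolynomial ι ℂ →ₗ[ℂ] MvPolynomial ι ℂ :=
  LinearMap.mulLeft ℂ (X i)

/-- The **annihilation operator** `aᵢ = ∂/∂Xᵢ` on `MvPolynomial ι ℂ`, so `aᵢ X^d = dᵢ X^{d-eᵢ}`
(Mathlib's `MvPolynomial.pderiv`). [cite: LSSY2005, App. A (A.7)–(A.9)] -/
def an (i : ι) : MvPolynomial ι ℂ →ₗ[ℂ] MvPolynomial ι ℂ :=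
  (pderiv i).toLinearMap

/-- `a†ᵢ p = Xᵢ p`. [cite: LSSY2005, App. A (A.9)] -/
theorem cr_apply (i : ι) (p : MvPolynomial ι ℂ) : cr i p = X i * p := rfl

/-- `aᵢ p = ∂ᵢ p`. [cite: LSSY2005, App. A (A.9)] -/
theorem an_apply (i : ι) (p : MvPolynomial ι ℂ) : an i p = pderiv i p := rfl

/-- `a†ᵢ |d⟩⟩ = |d + eᵢ⟩⟩` on the (unnormalised) occupation-number basis.
[cite: LSSY2005, App. A (A.9), (A.14)] -/
theorem cr_monomial (i : ι) (d : ι →₀ ℕ) (c : ℂ) :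
    cr i (monomial d c) = monomial (d + Finsupp.single i 1) c := by
  rw [cr_apply, add_comm, monomial_single_add, pow_one]

/-- `aᵢ |d⟩⟩ = dᵢ |d - eᵢ⟩⟩`. [cite: LSSY2005, App. A (A.9), (A.13)] -/
theorem an_monomial (i : ι) (d : ι →₀ ℕ) (c : ℂ) :
    an i (monomial d c) = (d i : ℂ) • monomial (d - Finsupp.single i 1) c := by
  rw [an_apply, pderiv_monomial, smul_monomial, smul_eq_mul, mul_comm]

/-- The vacuum `|0⟩ = 1` is annihilated: `aᵢ|0⟩ = 0`. [cite: LSSY2005, App. A (A.8)] -/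
theorem an_one (i : ι) : an i 1 = 0 := by
  rw [an_apply, pderiv_one]

/-- `a†ᵢ aᵢ |d⟩⟩ = dᵢ |d⟩⟩`: the occupation-number basis diagonalises `nᵢ = a†ᵢaᵢ`.
[cite: LSSY2005, App. A (A.11)] -/
theorem cr_an_monomial (i : ι) (d : ι →₀ ℕ) (c : ℂ) :
    cr i (an i (monomial d c)) = (d i : ℂ) • monomial d c := by
  rw [an_apply, cr_apply, X_mul_pderiv_monomial, ← Nat.cast_smul_eq_nsmul ℂ]

/-- **CCR** `aᵢ a†ⱼ = a†ⱼ aᵢ + δᵢⱼ`. [cite: LSSY2005, App. A (A.7)] -/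
theorem an_cr_apply [DecidableEq ι] (i j : ι) (p : MvPolynomial ι ℂ) :
    an i (cr j p) = cr j (an i p) + if i = j then p else 0 := by
  rw [an_apply, cr_apply, pderiv_mul, pderiv_X, cr_apply, an_apply, add_comm]
  congr 1
  by_cases h : i = j
  · subst h; simp
  · simp [h]

/-- **CCR**, operator form: `[aᵢ, a†ⱼ] = δᵢⱼ 1`. [cite: LSSY2005, App. A (A.7)] -/
theorem an_cr_sub_cr_an [DecidableEq ι] (i j : ι) :
    an i ∘ₗ cr j - cr j ∘ₗ an i = if i = j then LinearMap.id else 0 := by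
  refine LinearMap.ext fun p => ?_
  simp only [LinearMap.sub_apply, LinearMap.comp_apply, an_cr_apply, add_sub_cancel_left]
  split_ifs <;> rfl

/-- `[a†ᵢ, a†ⱼ] = 0`. [cite: LSSY2005, App. A (A.7)] -/
theorem cr_cr_comm (i j : ι) (p : MvPolynomial ι ℂ) : cr i (cr j p) = cr j (cr i p) := by
  simp only [cr_apply]; ring

/-- `[aᵢ, aⱼ] = 0` (equality of mixed partial derivatives). [cite: LSSY2005, App. A (A.7)] -/
theorem an_an_comm (i j : ι) (p : MvPolynomial ι ℂ) : an i (an j p) = an j (an i p) := by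
  classical
  simp only [an_apply]
  refine MvPolynomial.ext _ _ fun m => ?_
  simp only [coeff_pderiv]
  by_cases h : i = j
  · subst h; rfl
  · rw [add_right_comm]
    simp only [Finsupp.coe_add, Pi.add_apply, Finsupp.single_eq_of_ne h,
      Finsupp.single_eq_of_ne (Ne.symm h), add_zero]
    ring

/-! ### Number operators and the `N`-particle sectors -/

/-- The **number operator** `nᵢ = a†ᵢ aᵢ` of the mode `i`. [cite: LSSY2005, App. A (A.11)] -/
def numberOp (i : ι) : MvPolynomial ι ℂ →ₗ[ℂ] MvPolynomial ι ℂ := cr i ∘ₗ an i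

/-- `nᵢ p = a†ᵢ (aᵢ p)`. [cite: LSSY2005, App. A (A.11)] -/
theorem numberOp_apply (i : ι) (p : MvPolynomial ι ℂ) : numberOp i p = cr i (an i p) := rfl

/-- `nᵢ |d⟩⟩ = dᵢ |d⟩⟩`. [cite: LSSY2005, App. A (A.11)] -/
theorem numberOp_monomial (i : ι) (d : ι →₀ ℕ) (c : ℂ) :
    numberOp i (monomial d c) = (d i : ℂ) • monomial d c :=
  cr_an_monomial i d c

/-- `nᵢ` multiplies the amplitude of `|d⟩⟩` by `dᵢ`. [cite: LSSY2005, App. A (A.11)] -/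
theorem coeff_numberOp (i : ι) (p : MvPolynomial ι ℂ) (d : ι →₀ ℕ) :
    coeff d (numberOp i p) = (d i : ℂ) * coeff d p := by
  classical
  induction p using MvPolynomial.induction_on' with
  | monomial e a =>
    rw [numberOp_monomial, coeff_smul, coeff_monomial, smul_eq_mul]
    split_ifs with h
    · rw [h]
    · rw [mul_zero, mul_zero]
  | add p q hp hq => rw [map_add, coeff_add, coeff_add, hp, hq, mul_add]

/-- `[nᵢ, a†ⱼ] = δᵢⱼ a†ⱼ`. [cite: LSSY2005, App. A (A.7), (A.11)] -/
theorem numberOp_cr_apply [DecidableEq ι] (i j : ι) (p : MvPolynomial ι ℂ) :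
    numberOp i (cr j p) = cr j (numberOp i p) + if i = j then cr j p else 0 := by
  rw [numberOp_apply, an_cr_apply, map_add, cr_cr_comm, numberOp_apply]
  by_cases h : i = j
  · subst h; simp
  · simp [h]

/-- `[aⱼ, nᵢ] = δᵢⱼ aⱼ`. [cite: LSSY2005, App. A (A.7), (A.11)] -/
theorem an_numberOp_apply [DecidableEq ι] (i j : ι) (p : MvPolynomial ι ℂ) :
    an j (numberOp i p) = numberOp i (an j p) + if i = j then an j p else 0 := by
  rw [numberOp_apply, an_cr_apply, an_an_comm, numberOp_apply]
  by_cases h : i = j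
  · subst h; simp
  · simp [h, Ne.symm h]

/-- `a†ᵢ` raises the particle number by one: it maps the `N`-particle sector (homogeneous
polynomials of degree `N`, Mathlib's `MvPolynomial.IsHomogeneous · N` / `homogeneousSubmodule ι ℂ N`)
to the `(N+1)`-particle sector. [cite: LSSY2005, App. A (A.14)] -/
theorem isHomogeneous_cr {i : ι} {p : MvPolynomial ι ℂ} {N : ℕ} (hp : p.IsHomogeneous N) :
    (cr i p).IsHomogeneous (N + 1) := by
  rw [cr_apply, add_comm]
  exact (isHomogeneous_X ℂ i).mul hp

/-- `aᵢ` lowers the particle number by one (`N`-sector → `(N-1)`-sector; the `0`-sector is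
killed). [cite: LSSY2005, App. A (A.13)] -/
theorem isHomogeneous_an {i : ι} {p : MvPolynomial ι ℂ} {N : ℕ} (hp : p.IsHomogeneous N) :
    (an i p).IsHomogeneous (N - 1) := by
  classical
  intro d hd
  rw [an_apply, coeff_pderiv] at hd
  have h1 : coeff (d + Finsupp.single i 1) p ≠ 0 := fun h => hd (by rw [h, zero_mul])
  have h2 : Finsupp.weight (1 : ι → ℕ) (d + Finsupp.single i 1) = N := hp h1
  rw [map_add, Finsupp.weight_single, Pi.one_apply, smul_eq_mul, mul_one] at h2
  change Finsupp.weight (1 : ι → ℕ) d = N - 1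
  omega

/-- `nᵢ` conserves the particle number. [cite: LSSY2005, App. A (A.11)] -/
theorem isHomogeneous_numberOp {i : ι} {p : MvPolynomial ι ℂ} {N : ℕ} (hp : p.IsHomogeneous N) :
    (numberOp i p).IsHomogeneous N := by
  intro d hd
  rw [coeff_numberOp] at hd
  exact hp (right_ne_zero_of_mul hd)

/-- The number-conserving bilinears `a†ᵢ aⱼ` preserve every `N`-particle sector, `N ≥ 1` (and
kill the vacuum sector). [cite: LSSY2005, App. A (A.15)] -/
theorem isHomogeneous_cr_an {i j : ι} {p : MvPolynomial ι ℂ} {N : ℕ} (hp : p.IsHomogeneous N)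
    (hN : N ≠ 0) : (cr i (an j p)).IsHomogeneous N := by
  have h := isHomogeneous_cr (i := i) (isHomogeneous_an (i := j) hp)
  rwa [Nat.sub_add_cancel (Nat.one_le_iff_ne_zero.mpr hN)] at h

/-! ### The Fock (Bargmann) inner product; `a†` is the adjoint of `a` -/

/-- `d! = Πᵢ (dᵢ)!`, the squared norm of the unnormalised occupation vector
`|d⟩⟩ = Πᵢ (a†ᵢ)^{dᵢ}|0⟩` (so `|d⟩ = |d⟩⟩/√(d!)` is the normalised occupation-number basis).
[folklore] -/
def occFactorial (d : ι →₀ ℕ) : ℕ := d.prod fun _ n => n.factorial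

/-- `d! > 0`. [folklore] -/
theorem occFactorial_pos (d : ι →₀ ℕ) : 0 < occFactorial d :=
  Finset.prod_pos fun _ _ => Nat.factorial_pos _

/-- `d!` as a product over any finite set containing the support. [folklore] -/
theorem occFactorial_eq_prod_of_subset (d : ι →₀ ℕ) {s : Finset ι} (hs : d.support ⊆ s) :
    occFactorial d = ∏ j ∈ s, (d j).factorial :=
  Finsupp.prod_of_support_subset d hs (fun _ n => n.factorial) fun _ _ => Nat.factorial_zero

/-- `(d + eᵢ)! = d! (dᵢ + 1)` — the origin of the `√(n+1)` in `a†|n⟩ = √(n+1)|n+1⟩`. [folklore] -/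
theorem occFactorial_add_single [DecidableEq ι] (d : ι →₀ ℕ) (i : ι) :
    occFactorial (d + Finsupp.single i 1) = occFactorial d * (d i + 1) := by
  set s := (d + Finsupp.single i 1).support with hs
  have hi : i ∈ s := by
    rw [hs, Finsupp.mem_support_iff]
    simp
  have hsub : d.support ⊆ s := by
    intro j hj
    rw [hs, Finsupp.mem_support_iff]
    rw [Finsupp.mem_support_iff] at hj
    simp only [Finsupp.coe_add, Pi.add_apply]
    omega
  rw [occFactorial_eq_prod_of_subset _ subset_rfl, occFactorial_eq_prod_of_subset d hsub,
    ← Finset.mul_prod_erase _ _ hi, ← Finset.mul_prod_erase _ _ hi]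
  have h1 : ∏ j ∈ s.erase i, ((d + Finsupp.single i 1 : ι →₀ ℕ) j).factorial =
      ∏ j ∈ s.erase i, (d j).factorial := by
    refine Finset.prod_congr rfl fun j hj => ?_
    rw [Finsupp.coe_add, Pi.add_apply, Finsupp.single_eq_of_ne (Finset.ne_of_mem_erase hj),
      add_zero]
  rw [h1]
  simp only [Finsupp.coe_add, Pi.add_apply, Finsupp.single_eq_same, Nat.factorial_succ]
  ring

/-- The **Fock inner product** (Bargmann inner product) on `MvPolynomial ι ℂ`:
`⟨p, q⟩ = Σ_d d! · conj(p_d) · q_d`, i.e. the occupation vectors `X^d = |d⟩⟩` are orthogonal with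
`‖X^d‖² = d!`; conjugate-linear in the first argument. It is the inner product of the Fock space
restricted to finite-excitation vectors, for which `a†ᵢ` is adjoint to `aᵢ` (`fockInner_cr_left`).
[folklore] -/
def fockInner (p q : MvPolynomial ι ℂ) : ℂ :=
  ∑ d ∈ p.support, (occFactorial d : ℂ) * (conj (coeff d p) * coeff d q)

/-- The defining sum may be taken over any finite set containing the support of the first
argument. [folklore] -/
theorem fockInner_eq_sum_of_subset {p : MvPolynomial ι ℂ} (q : MvPolynomial ι ℂ)
    {s : Finset (ι →₀ ℕ)} (hs : p.support ⊆ s) :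
    fockInner p q = ∑ d ∈ s, (occFactorial d : ℂ) * (conj (coeff d p) * coeff d q) := by
  unfold fockInner
  refine Finset.sum_subset hs fun d _ hd => ?_
  rw [MvPolynomial.notMem_support_iff.mp hd, map_zero, zero_mul, mul_zero]

/-- Additivity in the first argument. [folklore] -/
theorem fockInner_add_left (p p' q : MvPolynomial ι ℂ) :
    fockInner (p + p') q = fockInner p q + fockInner p' q := by
  classical
  rw [fockInner_eq_sum_of_subset q (s := p.support ∪ p'.support ∪ (p + p').support)
      Finset.subset_union_right,
    fockInner_eq_sum_of_subset q (s := p.support ∪ p'.support ∪ (p + p').support)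
      (Finset.subset_union_left.trans Finset.subset_union_left),
    fockInner_eq_sum_of_subset q (s := p.support ∪ p'.support ∪ (p + p').support)
      (Finset.subset_union_right.trans Finset.subset_union_left),
    ← Finset.sum_add_distrib]
  refine Finset.sum_congr rfl fun d _ => ?_
  rw [coeff_add, map_add]; ring

/-- Additivity in the second argument. [folklore] -/
theorem fockInner_add_right (p q q' : MvPolynomial ι ℂ) :
    fockInner p (q + q') = fockInner p q + fockInner p q' := by
  unfold fockInner
  rw [← Finset.sum_add_distrib]
  refine Finset.sum_congr rfl fun d _ => ?_
  rw [coeff_add]; ring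

/-- Conjugate-homogeneity in the first argument. [folklore] -/
theorem fockInner_smul_left (c : ℂ) (p q : MvPolynomial ι ℂ) :
    fockInner (c • p) q = conj c * fockInner p q := by
  rw [fockInner_eq_sum_of_subset q support_smul, fockInner, Finset.mul_sum]
  refine Finset.sum_congr rfl fun d _ => ?_
  rw [coeff_smul, smul_eq_mul, map_mul]; ring

/-- Homogeneity in the second argument. [folklore] -/
theorem fockInner_smul_right (c : ℂ) (p q : MvPolynomial ι ℂ) :
    fockInner p (c • q) = c * fockInner p q := by
  rw [fockInner, fockInner, Finset.mul_sum]
  refine Finset.sum_congr rfl fun d _ => ?_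
  rw [coeff_smul, smul_eq_mul]; ring

/-- `⟨0, q⟩ = 0`. [folklore] -/
theorem fockInner_zero_left (q : MvPolynomial ι ℂ) : fockInner 0 q = 0 := by
  simp [fockInner]

/-- `⟨p, 0⟩ = 0`. [folklore] -/
theorem fockInner_zero_right (p : MvPolynomial ι ℂ) : fockInner p 0 = 0 := by
  simp [fockInner]

/-- Hermitian symmetry `conj ⟨p, q⟩ = ⟨q, p⟩`. [folklore] -/
theorem conj_fockInner (p q : MvPolynomial ι ℂ) : conj (fockInner p q) = fockInner q p := by
  classical
  rw [fockInner_eq_sum_of_subset q (s := p.support ∪ q.support) Finset.subset_union_left,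
    fockInner_eq_sum_of_subset p (s := p.support ∪ q.support) Finset.subset_union_right, map_sum]
  refine Finset.sum_congr rfl fun d _ => ?_
  simp only [map_mul, Complex.conj_natCast, Complex.conj_conj]
  ring

/-- **Orthogonality of the occupation-number basis**: `⟨a X^d, b X^e⟩ = δ_{de} d! conj(a) b`.
[folklore] -/
theorem fockInner_monomial (d e : ι →₀ ℕ) (a b : ℂ) [Decidable (d = e)] :
    fockInner (monomial d a) (monomial e b) =
      if d = e then (occFactorial d : ℂ) * (conj a * b) else 0 := by
  classical
  rw [fockInner_eq_sum_of_subset _ support_monomial_subset, Finset.sum_singleton, coeff_monomial,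
    coeff_monomial, if_pos rfl]
  by_cases h : d = e
  · subst h; simp
  · rw [if_neg h, if_neg (Ne.symm h)]; simp

/-- `‖p‖² = Σ_d d! |p_d|²` (as a real number cast to `ℂ`). [folklore] -/
theorem fockInner_self (p : MvPolynomial ι ℂ) :
    fockInner p p = ((∑ d ∈ p.support, (occFactorial d : ℝ) * ‖coeff d p‖ ^ 2 : ℝ) : ℂ) := by
  rw [fockInner, Complex.ofReal_sum]
  refine Finset.sum_congr rfl fun d _ => ?_
  rw [Complex.conj_mul', Complex.ofReal_mul, Complex.ofReal_natCast, Complex.ofReal_pow]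

/-- Positivity `⟨p, p⟩ ≥ 0`. [folklore] -/
theorem fockInner_self_re_nonneg (p : MvPolynomial ι ℂ) : 0 ≤ (fockInner p p).re := by
  rw [fockInner_self, Complex.ofReal_re]
  exact Finset.sum_nonneg fun d _ => by positivity

/-- Definiteness `⟨p, p⟩ = 0 ↔ p = 0`. [folklore] -/
theorem fockInner_self_eq_zero {p : MvPolynomial ι ℂ} : fockInner p p = 0 ↔ p = 0 := by
  constructor
  · intro h
    rw [fockInner_self, Complex.ofReal_eq_zero] at h
    have h' := (Finset.sum_eq_zero_iff_of_nonneg fun d _ => by positivity).mp h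
    refine MvPolynomial.ext _ _ fun d => ?_
    rw [coeff_zero]
    by_contra hd
    have := h' d (MvPolynomial.mem_support_iff.mpr hd)
    have hpos : (0 : ℝ) < occFactorial d * ‖coeff d p‖ ^ 2 := by
      have := occFactorial_pos d
      positivity
    exact hpos.ne' this
  · rintro rfl; exact fockInner_zero_left 0

/-- **`a†ᵢ` is the adjoint of `aᵢ`**: `⟨a†ᵢ p, q⟩ = ⟨p, aᵢ q⟩` ("its Hermitian conjugate (the
annihilation operator)"). [cite: LSSY2005, App. A (after (A.6))] -/
theorem fockInner_cr_left (i : ι) (p q : MvPolynomial ι ℂ) :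
    fockInner (cr i p) q = fockInner p (an i q) := by
  classical
  induction p using MvPolynomial.induction_on' with
  | add p p' hp hp' => rw [map_add, fockInner_add_left, fockInner_add_left, hp, hp']
  | monomial d a =>
    induction q using MvPolynomial.induction_on' with
    | add q q' hq hq' => rw [map_add, fockInner_add_right, fockInner_add_right, hq, hq']
    | monomial e b =>
      rw [cr_monomial, an_monomial, smul_monomial, fockInner_monomial, fockInner_monomial]
      by_cases h : d + Finsupp.single i 1 = e
      · subst h
        rw [if_pos rfl, add_tsub_cancel_right, if_pos rfl, occFactorial_add_single]
        simp only [Finsupp.coe_add, Pi.add_apply, Finsupp.single_eq_same, smul_eq_mul]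
        push_cast
        ring
      · rw [if_neg h]
        by_cases h' : d = e - Finsupp.single i 1
        · have he : e i = 0 := by
            by_contra hei
            exact h (by rw [h', Finsupp.sub_add_single_one_cancel hei])
          rw [he]; simp
        · rw [if_neg h']

/-- **Occupation expectation**: `⟨p, a†ᵢaᵢ p⟩ = Σ_d dᵢ · d! |p_d|² = Σ_d dᵢ |⟨d|p⟩|²` — the
expected number of particles in mode `i` is the `dᵢ`-weighted sum of the squared (normalised)
amplitudes. [cite: LSSY2005, App. A (A.11)] -/
theorem fockInner_numberOp_self (i : ι) (p : MvPolynomial ι ℂ) :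
    fockInner p (numberOp i p) =
      ((∑ d ∈ p.support, (occFactorial d : ℝ) * (d i) * ‖coeff d p‖ ^ 2 : ℝ) : ℂ) := by
  rw [fockInner, Complex.ofReal_sum]
  refine Finset.sum_congr rfl fun d _ => ?_
  have h : conj (coeff d p) * coeff d p = ((‖coeff d p‖ : ℂ)) ^ 2 := by
    rw [Complex.conj_mul']
  rw [coeff_numberOp]
  push_cast
  linear_combination ((occFactorial d : ℂ) * (d i : ℂ)) * h

/-! ### Momentum pairs and the `su(1,1)` pair algebra -/

section Pairs

variable [AddGroup ι]

/-- The **pair annihilator** `a₋ₖ aₖ` (modes labelled by an additive group, `-k` = time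
reversal). [cite: DukelskySchuck2001, (1)] -/
def pairAn (k : ι) : MvPolynomial ι ℂ →ₗ[ℂ] MvPolynomial ι ℂ := an (-k) ∘ₗ an k

/-- The **pair creator** `a†ₖ a†₋ₖ = (a₋ₖ aₖ)†`. [cite: DukelskySchuck2001, (1)] -/
def pairCr (k : ι) : MvPolynomial ι ℂ →ₗ[ℂ] MvPolynomial ι ℂ := cr k ∘ₗ cr (-k)

/-- `a₋ₖaₖ p = a₋ₖ (aₖ p)`. [cite: DukelskySchuck2001, (1)] -/
theorem pairAn_apply (k : ι) (p : MvPolynomial ι ℂ) : pairAn k p = an (-k) (an k p) := rfl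

/-- `a†ₖa†₋ₖ p = a†ₖ (a†₋ₖ p)`. [cite: DukelskySchuck2001, (1)] -/
theorem pairCr_apply (k : ι) (p : MvPolynomial ι ℂ) : pairCr k p = cr k (cr (-k) p) := rfl

/-- `a†ₖa†₋ₖ` is the adjoint of `a₋ₖaₖ`. [cite: DukelskyPittelSierra2004, §III (KB)] -/
theorem fockInner_pairCr_left (k : ι) (p q : MvPolynomial ι ℂ) :
    fockInner (pairCr k p) q = fockInner p (pairAn k q) := by
  rw [pairCr_apply, fockInner_cr_left, fockInner_cr_left, pairAn_apply]

/-- `a₋ₖaₖ` lowers the particle number by two. [cite: LSSY2005, App. A (A.13)] -/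
theorem isHomogeneous_pairAn {k : ι} {p : MvPolynomial ι ℂ} {N : ℕ} (hp : p.IsHomogeneous N) :
    (pairAn k p).IsHomogeneous (N - 2) := by
  have h := isHomogeneous_an (i := -k) (isHomogeneous_an (i := k) hp)
  rwa [Nat.sub_sub, ← pairAn_apply] at h

/-- `a†ₖa†₋ₖ` raises the particle number by two. [cite: LSSY2005, App. A (A.14)] -/
theorem isHomogeneous_pairCr {k : ι} {p : MvPolynomial ι ℂ} {N : ℕ} (hp : p.IsHomogeneous N) :
    (pairCr k p).IsHomogeneous (N + 2) := by
  have h := isHomogeneous_cr (i := k) (isHomogeneous_cr (i := -k) hp)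
  rwa [add_assoc, ← pairCr_apply] at h

/-- The **band pair annihilator** `P_B = Σ_{k ∈ B} a₋ₖ aₖ` of a finite set of modes `B` (for the
torus band `B_Λ` this is the `P_Λ` of route BECRichardsonAnchor; `P_B† P_B = Σ_{k,k'∈B} a†ₖa†₋ₖa₋ₖ'aₖ'`
is the anchor's quartic term, which preserves every `N`-sector). In the level notation of
[DukelskySchuck2001, (1)], `P_B = Σ_{levels Λ ⊆ B} A_Λ` with `A_Λ = Σ_{α∈Λ} a_ᾱ a_α`.
[cite: DukelskySchuck2001, (1)] -/
def bandPairAn (B : Finset ι) : MvPolynomial ι ℂ →ₗ[ℂ] MvPolynomial ι ℂ := ∑ k ∈ B, pairAn k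

/-- `P_B p = Σ_{k∈B} a₋ₖaₖ p`. [cite: DukelskySchuck2001, (1)] -/
theorem bandPairAn_apply (B : Finset ι) (p : MvPolynomial ι ℂ) :
    bandPairAn B p = ∑ k ∈ B, pairAn k p := by
  rw [bandPairAn, LinearMap.sum_apply]

/-- `P_B` lowers the particle number by two (so `P_B†P_B` conserves it). [cite: LSSY2005, App. A (A.13)] -/
theorem isHomogeneous_bandPairAn (B : Finset ι) {p : MvPolynomial ι ℂ} {N : ℕ}
    (hp : p.IsHomogeneous N) : (bandPairAn B p).IsHomogeneous (N - 2) := by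
  rw [bandPairAn_apply]
  exact IsHomogeneous.sum B _ _ fun k _ => isHomogeneous_pairAn hp

/-- **`su(1,1)`, generic level**: `[a₋ₖaₖ, a†ₖa†₋ₖ] = nₖ + n₋ₖ + 1` for `k ≠ -k` (i.e.
`[K⁻_k, K⁺_k] = 2K⁰_k` with `K⁰_k = ½(nₖ + n₋ₖ + 1)`).
[cite: DukelskyPittelSierra2004, §III (KB) and the SU(1,1) relations] -/
theorem pairAn_pairCr_sub [DecidableEq ι] {k : ι} (hk : k ≠ -k) (p : MvPolynomial ι ℂ) :
    pairAn k (pairCr k p) - pairCr k (pairAn k p) = numberOp k p + numberOp (-k) p + p := by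
  have hk' : -k ≠ k := Ne.symm hk
  simp only [pairAn_apply, pairCr_apply, numberOp_apply, an_cr_apply, hk, hk', if_true, if_false,
    map_add, add_zero]
  abel

omit [AddGroup ι] in
/-- **`su(1,1)`, self-conjugate level**: `[aᵢaᵢ, a†ᵢa†ᵢ] = 4nᵢ + 2` (i.e. `[K⁻_0, K⁺_0] = 2K⁰_0` with
`K⁺_0 = ½a†₀²`, `K⁻_0 = ½a₀²`, `K⁰_0 = (2n₀+1)/4`).
[cite: DukelskyPittelSierra2004, §III (KB) and the SU(1,1) relations] -/
theorem an_an_cr_cr_sub [DecidableEq ι] (i : ι) (p : MvPolynomial ι ℂ) :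
    an i (an i (cr i (cr i p))) - cr i (cr i (an i (an i p))) =
      (4 : ℂ) • numberOp i p + (2 : ℂ) • p := by
  simp only [numberOp_apply, an_cr_apply, if_true, map_add]
  rw [ofNat_smul_eq_nsmul ℂ 4, ofNat_smul_eq_nsmul ℂ 2]
  abel

end Pairs

section SU11

variable [AddGroup ι] [DecidableEq ι]

/-- The time-reversal **level** `{k, -k}` of a mode (a singleton when `k = -k`, e.g. `k = 0`); its
cardinality is the pair degeneracy `Ω` of the level. [cite: DukelskyPittelSierra2004, §III (KB)] -/
def level (k : ι) : Finset ι := {k, -k}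

/-- A self-conjugate mode is its own level (`Ω = 1`: "for bosons a single-particle state can be its
own time-reversal partner"). [cite: DukelskyPittelSierra2004, §III (after (KB))] -/
theorem level_eq_singleton {k : ι} (hk : k = -k) : level k = {k} := by
  rw [level, ← hk]
  simp

/-- A generic level has `Ω = 2`. [cite: DukelskyPittelSierra2004, §III (after (KB))] -/
theorem card_level_of_ne {k : ι} (hk : k ≠ -k) : (level k).card = 2 :=
  Finset.card_pair hk

/-- The `su(1,1)` raising generator of the level of `k`: `K⁺_k = ½ Σ_{m ∈ {k,-k}} a†ₘ a†₋ₘ`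
(`= a†ₖa†₋ₖ` for `k ≠ -k`, `= ½ a†ₖ²` for `k = -k`). [cite: DukelskyPittelSierra2004, §III (KB)] -/
def kPlus (k : ι) : MvPolynomial ι ℂ →ₗ[ℂ] MvPolynomial ι ℂ :=
  (2 : ℂ)⁻¹ • ∑ m ∈ level k, cr m ∘ₗ cr (-m)

/-- The `su(1,1)` lowering generator `K⁻_k = ½ Σ_{m ∈ {k,-k}} a₋ₘ aₘ = (K⁺_k)†`.
[cite: DukelskyPittelSierra2004, §III (KB)] -/
def kMinus (k : ι) : MvPolynomial ι ℂ →ₗ[ℂ] MvPolynomial ι ℂ :=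
  (2 : ℂ)⁻¹ • ∑ m ∈ level k, an (-m) ∘ₗ an m

/-- The `su(1,1)` Cartan generator `K⁰_k = ½ Σ_{m ∈ {k,-k}} nₘ + ¼ Ω_k`, `Ω_k = #{k,-k}`
(`= ½(nₖ + n₋ₖ + 1)` for `k ≠ -k`, `= ½n₀ + ¼` for `k = 0`). [cite: DukelskyPittelSierra2004, §III (KB)] -/
def kZero (k : ι) : MvPolynomial ι ℂ →ₗ[ℂ] MvPolynomial ι ℂ :=
  (2 : ℂ)⁻¹ • ∑ m ∈ level k, numberOp m + ((level k).card / 4 : ℂ) • LinearMap.id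

/-- `K⁺_k = a†ₖa†₋ₖ` on a generic level. [cite: DukelskyPittelSierra2004, §III (KB)] -/
theorem kPlus_apply_of_ne {k : ι} (hk : k ≠ -k) (p : MvPolynomial ι ℂ) :
    kPlus k p = pairCr k p := by
  rw [kPlus, LinearMap.smul_apply, LinearMap.sum_apply, level, Finset.sum_pair hk,
    LinearMap.comp_apply, LinearMap.comp_apply, neg_neg, cr_cr_comm (-k) k, ← pairCr_apply,
    ← two_smul ℂ, smul_smul, inv_mul_cancel₀ two_ne_zero, one_smul]

/-- `K⁺_k = ½ a†ₖ²` on a self-conjugate level. [cite: DukelskyPittelSierra2004, §III (KB)] -/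
theorem kPlus_apply_of_eq {k : ι} (hk : k = -k) (p : MvPolynomial ι ℂ) :
    kPlus k p = (2 : ℂ)⁻¹ • cr k (cr k p) := by
  rw [kPlus, LinearMap.smul_apply, LinearMap.sum_apply, level_eq_singleton hk, Finset.sum_singleton,
    LinearMap.comp_apply, ← hk]

/-- `K⁻_k = a₋ₖaₖ` on a generic level. [cite: DukelskyPittelSierra2004, §III (KB)] -/
theorem kMinus_apply_of_ne {k : ι} (hk : k ≠ -k) (p : MvPolynomial ι ℂ) :
    kMinus k p = pairAn k p := by
  rw [kMinus, LinearMap.smul_apply, LinearMap.sum_apply, level, Finset.sum_pair hk,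
    LinearMap.comp_apply, LinearMap.comp_apply, neg_neg, an_an_comm k (-k), ← pairAn_apply,
    ← two_smul ℂ, smul_smul, inv_mul_cancel₀ two_ne_zero, one_smul]

/-- `K⁻_k = ½ aₖ²` on a self-conjugate level. [cite: DukelskyPittelSierra2004, §III (KB)] -/
theorem kMinus_apply_of_eq {k : ι} (hk : k = -k) (p : MvPolynomial ι ℂ) :
    kMinus k p = (2 : ℂ)⁻¹ • an k (an k p) := by
  rw [kMinus, LinearMap.smul_apply, LinearMap.sum_apply, level_eq_singleton hk, Finset.sum_singleton,
    LinearMap.comp_apply, ← hk]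

/-- `K⁰_k = ½(nₖ + n₋ₖ + 1)` on a generic level. [cite: DukelskyPittelSierra2004, §III (KB)] -/
theorem kZero_apply_of_ne {k : ι} (hk : k ≠ -k) (p : MvPolynomial ι ℂ) :
    kZero k p = (2 : ℂ)⁻¹ • (numberOp k p + numberOp (-k) p + p) := by
  rw [kZero, LinearMap.add_apply, LinearMap.smul_apply, LinearMap.sum_apply, card_level_of_ne hk,
    level, Finset.sum_pair hk, LinearMap.smul_apply, LinearMap.id_apply, smul_add]
  norm_num

/-- `K⁰_k = ½nₖ + ¼` on a self-conjugate level. [cite: DukelskyPittelSierra2004, §III (KB)] -/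
theorem kZero_apply_of_eq {k : ι} (hk : k = -k) (p : MvPolynomial ι ℂ) :
    kZero k p = (2 : ℂ)⁻¹ • numberOp k p + (4 : ℂ)⁻¹ • p := by
  rw [kZero, LinearMap.add_apply, LinearMap.smul_apply, LinearMap.sum_apply, level_eq_singleton hk,
    Finset.sum_singleton, Finset.card_singleton, LinearMap.smul_apply, LinearMap.id_apply]
  norm_num

/-- `K⁻_k = (K⁺_k)†`. [cite: DukelskyPittelSierra2004, §III (KB)] -/
theorem fockInner_kPlus_left (k : ι) (p q : MvPolynomial ι ℂ) :
    fockInner (kPlus k p) q = fockInner p (kMinus k q) := by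
  by_cases hk : k = -k
  · rw [kPlus_apply_of_eq hk, kMinus_apply_of_eq hk, fockInner_smul_left, fockInner_smul_right,
      fockInner_cr_left, fockInner_cr_left, map_inv₀, map_ofNat]
  · rw [kPlus_apply_of_ne hk, kMinus_apply_of_ne hk, fockInner_pairCr_left]

/-- **The `su(1,1)` pair algebra**: `[K⁻_k, K⁺_k] = 2 K⁰_k` on every level (the bosonic sign of
`[K⁺_l, K⁻_l'] = ∓2δ_{ll'} K⁰_l`).
[cite: DukelskyPittelSierra2004, §III (KB) and the SU(1,1) commutation relations] -/
theorem kMinus_kPlus_sub (k : ι) (p : MvPolynomial ι ℂ) :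
    kMinus k (kPlus k p) - kPlus k (kMinus k p) = (2 : ℂ) • kZero k p := by
  by_cases hk : k = -k
  · rw [kPlus_apply_of_eq hk, kMinus_apply_of_eq hk, map_smul, kMinus_apply_of_eq hk, map_smul,
      map_smul, kPlus_apply_of_eq hk, kZero_apply_of_eq hk, smul_smul, smul_smul, ← smul_sub,
      an_an_cr_cr_sub, smul_add, smul_add, smul_smul, smul_smul, smul_smul, smul_smul]
    norm_num
  · rw [kPlus_apply_of_ne hk, kMinus_apply_of_ne hk, kMinus_apply_of_ne hk, kPlus_apply_of_ne hk,
      pairAn_pairCr_sub hk, kZero_apply_of_ne hk, smul_smul, mul_inv_cancel₀ two_ne_zero, one_smul]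

/-- `[K⁰_k, K⁺_k] = K⁺_k` on a generic level (from `[nᵢ, a†ⱼ] = δᵢⱼ a†ⱼ`).
[cite: DukelskyPittelSierra2004, §III the SU(1,1) commutation relations] -/
theorem kZero_kPlus_sub_of_ne {k : ι} (hk : k ≠ -k) (p : MvPolynomial ι ℂ) :
    kZero k (kPlus k p) - kPlus k (kZero k p) = kPlus k p := by
  have hk' : -k ≠ k := Ne.symm hk
  simp only [kPlus_apply_of_ne hk, kZero_apply_of_ne hk, pairCr_apply, map_add, map_smul,
    numberOp_cr_apply, hk, hk', if_true, if_false, add_zero, smul_add]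
  module

end SU11

end Fock

/-! ## B. The torus of side `L`: plane waves, momentum occupations, the band, `P_B` -/

/-! ### Modes, wave vectors, plane waves, momentum occupations -/

/-- **Momentum labels** `n ∈ ℤ³`: the modes of the torus of side `L` are the plane waves with wave
vectors `k = 2πn/L`, "the **k** are vectors of the form `(2π/L)(n₁, n₂, n₃)`".
[cite: LSSY2005, App. A (A.3)] -/
abbrev Momentum : Type := Fin 3 → ℤ

/-- The **wave vector** `k = 2πn/L ∈ (2π/L)ℤ³ ⊂ ℝ³` of the momentum label `n`.
[cite: LSSY2005, App. A (A.3)] -/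
def waveVector (L : ℝ) (n : Momentum) : Space :=
  toLp 2 fun j => 2 * Real.pi * (n j : ℝ) / L

/-- `k_j = 2πn_j/L`. [cite: LSSY2005, App. A (A.3)] -/
theorem waveVector_apply (L : ℝ) (n : Momentum) (j : Fin 3) :
    waveVector L n j = 2 * Real.pi * (n j : ℝ) / L := rfl

/-- `|k|² = 4π²|n|²/L²` (the kinetic energy `ε(k) = k²` of the mode in the units `ħ = 2m = 1`; this is
the weight in `tsum_sq_grad_cellFourierCoeff`). [cite: LSSY2005, App. A (A.6)] -/
theorem norm_waveVector_sq (L : ℝ) (n : Momentum) :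
    ‖waveVector L n‖ ^ 2 = 4 * Real.pi ^ 2 * (∑ j, (n j : ℝ) ^ 2) / L ^ 2 := by
  rw [EuclideanSpace.norm_eq, Real.sq_sqrt (Finset.sum_nonneg fun j _ => by positivity),
    Finset.mul_sum, Finset.sum_div]
  refine Finset.sum_congr rfl fun j _ => ?_
  rw [Real.norm_eq_abs, sq_abs]
  change (2 * Real.pi * (n j : ℝ) / L) ^ 2 = _
  ring

/-- The zero mode has `k = 0`. [cite: LSSY2005, App. A (A.3)] -/
@[simp]
theorem waveVector_zero (L : ℝ) : waveVector L 0 = 0 := by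
  ext j; simp [waveVector_apply]

/-- `k(-n) = -k(n)`. [cite: LSSY2005, App. A (A.3)] -/
theorem waveVector_neg (L : ℝ) (n : Momentum) : waveVector L (-n) = -waveVector L n := by
  ext j; simp [waveVector_apply]; ring

/-- The **normalised plane wave** `φₙ(x) = L^{-3/2} e^{2πi n·x/L} 1_cell(x) = L^{-3/2} e^{ik·x} 1_cell(x)`
of the torus of side `L` (a function on `ℝ³` supported in the fundamental cell, like
`constantMode`; `cellWave L n x = e^{2πi n·x/L}`). [cite: LSSY2005, App. A (A.3), (A.5)] -/
def planeWave (L : ℝ) (n : Momentum) : Space → ℂ :=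
  (cell L).indicator fun x => ((Real.sqrt (L ^ 3))⁻¹ : ℂ) * cellWave L n x

/-- On the cell `φₙ = L^{-3/2} eₙ`. [cite: LSSY2005, App. A (A.5)] -/
theorem planeWave_apply_of_mem {L : ℝ} {x : Space} (hx : x ∈ cell L) (n : Momentum) :
    planeWave L n x = ((Real.sqrt (L ^ 3))⁻¹ : ℂ) * cellWave L n x :=
  Set.indicator_of_mem hx _

/-- Off the cell `φₙ = 0`. [cite: LSSY2005, App. A (A.5)] -/
theorem planeWave_apply_of_not_mem {L : ℝ} {x : Space} (hx : x ∉ cell L) (n : Momentum) :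
    planeWave L n x = 0 :=
  Set.indicator_of_notMem hx _

/-- **The zero mode is the constant mode** `φ₀ = L^{-3/2} 1_cell` of `PeriodicBoseGas.lean`.
[cite: Fournais2020, (1.3)] -/
theorem planeWave_zero (L : ℝ) : planeWave L 0 = constantMode L := by
  funext x
  simp [planeWave, constantMode, cellWave_zero]

/-- `φₙ` is supported in the cell. [folklore] -/
theorem indicator_planeWave (L : ℝ) (n : Momentum) :
    (cell L).indicator (planeWave L n) = planeWave L n := by
  rw [planeWave, Set.indicator_indicator, Set.inter_self]

/-- `conj φₙ = φ₋ₙ` (time reversal). [folklore] -/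
theorem conj_planeWave (L : ℝ) (n : Momentum) (x : Space) :
    conj (planeWave L n x) = planeWave L (-n) x := by
  by_cases hx : x ∈ cell L
  · rw [planeWave_apply_of_mem hx, planeWave_apply_of_mem hx, map_mul, conj_cellWave, map_inv₀,
      Complex.conj_ofReal]
  · rw [planeWave_apply_of_not_mem hx, planeWave_apply_of_not_mem hx, map_zero]

/-- `|φₙ| ≤ L^{-3/2}`. [folklore] -/
theorem norm_planeWave_le (L : ℝ) (n : Momentum) (x : Space) :
    ‖planeWave L n x‖ ≤ |(Real.sqrt (L ^ 3))⁻¹| := by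
  by_cases hx : x ∈ cell L
  · rw [planeWave_apply_of_mem hx, norm_mul, norm_cellWave, mul_one, ← Complex.ofReal_inv,
      Complex.norm_real, Real.norm_eq_abs]
  · rw [planeWave_apply_of_not_mem hx, norm_zero]; positivity

/-- The **momentum occupation**
`n_k(Ψ) = ⟨φₙ, γ_Ψ φₙ⟩ = ⟨Ψ, a†_k a_k Ψ⟩ = N ∫_{cell^{N-1}} |∫_cell conj(φₙ(x)) Ψ(x,X') dx|² dX'`
of the plane wave `k = 2πn/L` in an `N`-body wave function on the cell (`cellOccupation` of
`PeriodicBoseGas.lean` at the mode `φₙ`; the first-quantised form of `⟨a†_k a_k⟩` by (A.13)).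
[cite: LSSY2005, App. A (A.11), (A.13) and §1.2 (1.17)] -/
def momentumOccupation (N : ℕ) (L : ℝ) (n : Momentum) (Ψ : Config N → ℂ) : ℝ≥0∞ :=
  cellOccupation N L (planeWave L n) Ψ

/-- Unfolding to `Literature…BoseGas.occupation` (the mode needs no further cell indicator).
[cite: LSSY2005, §1.2 (1.17)] -/
theorem momentumOccupation_eq (N : ℕ) (L : ℝ) (n : Momentum) (Ψ : Config N → ℂ) :
    momentumOccupation N L n Ψ = occupation N (planeWave L n) ((cellN N L).indicator Ψ) := by
  rw [momentumOccupation, cellOccupation, indicator_planeWave]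

/-- **`n₀(Ψ)` is the condensate occupation** `⟨Ψ, n₀Ψ⟩` of `PeriodicBoseGas.lean` (so the route's
`N - condensateOccupation` is the number of excited particles `⟨Ψ, n₊Ψ⟩`).
[cite: Fournais2020, (1.3)–(1.5)] -/
theorem momentumOccupation_zero (N : ℕ) (L : ℝ) (Ψ : Config N → ℂ) :
    momentumOccupation N L 0 Ψ = condensateOccupation N L Ψ := by
  rw [momentumOccupation_eq, planeWave_zero, condensateOccupation]

/-! ### Orthonormality of the plane waves -/

/-- **Orthonormality of the plane waves in `L²(ℝ³)`** (equivalently in `L²(cell)`):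
`∫ conj(φₘ) φₙ = δₘₙ`. [cite: LSSY2005, App. A (A.3)–(A.5)] -/
theorem integral_conj_planeWave_mul_planeWave {L : ℝ} (hL : 0 < L) (m n : Momentum) :
    ∫ x, conj (planeWave L m x) * planeWave L n x = if m = n then 1 else 0 := by
  have hL3 : 0 < L ^ 3 := by positivity
  have h1 : (fun x => conj (planeWave L m x) * planeWave L n x) =
      (cell L).indicator fun x => ((L ^ 3)⁻¹ : ℝ) • (conj (cellWave L m x) * cellWave L n x) := by
    funext x
    by_cases hx : x ∈ cell L
    · have h2 : ((Real.sqrt (L ^ 3) : ℂ))⁻¹ * ((Real.sqrt (L ^ 3) : ℂ))⁻¹ = ((L ^ 3 : ℝ) : ℂ)⁻¹ := by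
        rw [← mul_inv, ← Complex.ofReal_mul, Real.mul_self_sqrt hL3.le]
      rw [Set.indicator_of_mem hx, planeWave_apply_of_mem hx, planeWave_apply_of_mem hx, map_mul,
        map_inv₀, Complex.conj_ofReal, Complex.real_smul, Complex.ofReal_inv, ← h2]
      ring
    · rw [Set.indicator_of_notMem hx, planeWave_apply_of_not_mem hx, map_zero, zero_mul]
  rw [h1, integral_indicator (measurableSet_cell L), integral_smul, ← cellFourierCoeff_eq_integral hL,
    cellFourierCoeff_cellWave hL]

/-- `‖L^{-3/2}‖² = L⁻³` in `ℝ≥0∞`. [folklore] -/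
theorem nnnorm_inv_sqrt_sq {L : ℝ} (hL : 0 < L) :
    ((‖((Real.sqrt (L ^ 3) : ℂ))⁻¹‖₊ : ℝ≥0∞) ^ 2) = (ENNReal.ofReal L ^ 3)⁻¹ := by
  have hL3 : 0 < L ^ 3 := by positivity
  rw [coe_nnnorm_sq_eq_ofReal, norm_inv, Complex.norm_real, Real.norm_of_nonneg (Real.sqrt_nonneg _),
    inv_pow, Real.sq_sqrt hL3.le, ENNReal.ofReal_inv_of_pos hL3, ENNReal.ofReal_pow hL.le]

/-- **The plane waves are normalised modes**: `∫ ‖φₙ‖² = 1`, in the `ℝ≥0∞` form consumed by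
`Literature…BoseGas.maxOccupation`. [cite: LSSY2005, App. A (A.5)] -/
theorem lintegral_nnnorm_sq_planeWave {L : ℝ} (hL : 0 < L) (n : Momentum) :
    ∫⁻ x, (‖planeWave L n x‖₊ : ℝ≥0∞) ^ 2 = 1 := by
  have hL3 : ENNReal.ofReal L ^ 3 ≠ 0 := pow_ne_zero _ (by simpa using hL)
  have h : (fun x => (‖planeWave L n x‖₊ : ℝ≥0∞) ^ 2) =
      (cell L).indicator fun _ => (ENNReal.ofReal L ^ 3)⁻¹ := by
    funext x
    by_cases hx : x ∈ cell L
    · rw [Set.indicator_of_mem hx, planeWave_apply_of_mem hx, nnnorm_mul, ENNReal.coe_mul, mul_pow,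
        nnnorm_inv_sqrt_sq hL]
      have h1 : ((‖cellWave L n x‖₊ : ℝ≥0∞)) = 1 := by
        rw [← ENNReal.coe_one, ENNReal.coe_inj, ← NNReal.coe_inj, coe_nnnorm, norm_cellWave,
          NNReal.coe_one]
      rw [h1, one_pow, mul_one]
    · rw [Set.indicator_of_notMem hx, planeWave_apply_of_not_mem hx, nnnorm_zero, ENNReal.coe_zero,
        zero_pow two_ne_zero]
  rw [h, lintegral_indicator (measurableSet_cell L), setLIntegral_const, volume_cell,
    ENNReal.inv_mul_cancel hL3 (ENNReal.pow_ne_top ENNReal.ofReal_ne_top)]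

/-! ### The momentum band and its kernel -/

/-- The **momentum band** `B_M = {-M, …, M}³ ⊂ ℤ³` (the route's `B_Λ = (2π/L){-M..M}³` with
`M = ⌊ΛL/2π⌋`, written on labels; literally the index set of the route's kernel `w`; the finite set of
paired levels of the pairing Hamiltonian [DukelskySchuck2001, (1)] in the torus geometry). [folklore] -/
def momentumBand (M : ℕ) : Finset Momentum :=
  Fintype.piFinset fun _ : Fin 3 => Finset.Icc (-(M : ℤ)) M

/-- `n ∈ B_M ↔ |nⱼ| ≤ M` for all `j`. [folklore] -/
theorem mem_momentumBand {M : ℕ} {n : Momentum} : n ∈ momentumBand M ↔ ∀ j, |n j| ≤ M := by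
  simp [momentumBand, abs_le]

/-- The band is closed under time reversal `k ↦ -k`. [folklore] -/
theorem neg_mem_momentumBand {M : ℕ} {n : Momentum} (hn : n ∈ momentumBand M) :
    -n ∈ momentumBand M := by
  rw [mem_momentumBand] at hn ⊢
  simpa using hn

/-- The zero mode lies in every band. [folklore] -/
theorem zero_mem_momentumBand (M : ℕ) : (0 : Momentum) ∈ momentumBand M :=
  mem_momentumBand.mpr fun j => by simp

/-- The **band kernel** `w(x,y) = Σ_{m ∈ B_M} e^{2πi m·(x-y)/L}` — verbatim the kernel `w` of the route
items `RichardsonAnchorBEC` / `BeliaevDeformationBEC` (`bandKernel_eq`); on the cell it is `L³` times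
the integral kernel `Σ_{k∈B_M} φ_k(x) φ_{-k}(y)` of `P_{B_M}` (`sum_planeWave_mul_planeWave_neg`).
[cite: LSSY2005, App. A (A.3)] -/
def bandKernel (L : ℝ) (M : ℕ) (x y : Space) : ℂ :=
  ∑ m ∈ momentumBand M,
    Complex.exp (2 * Real.pi * Complex.I / L * ∑ j : Fin 3, (m j : ℂ) * ((x j - y j : ℝ) : ℂ))

/-- `bandKernel` unfolded to the literal expression used in the route's Theses file. [folklore] -/
theorem bandKernel_eq (L : ℝ) (M : ℕ) (x y : Space) :
    bandKernel L M x y = ∑ m ∈ Fintype.piFinset (fun _ : Fin 3 => Finset.Icc (-(M : ℤ)) M),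
      Complex.exp (2 * Real.pi * Complex.I / L * ∑ j : Fin 3, (m j : ℂ) * ((x j - y j : ℝ) : ℂ)) :=
  rfl

/-- `eₘ(x) e₋ₘ(y) = e^{2πi m·(x-y)/L}`. [folklore] -/
theorem cellWave_mul_cellWave_neg (L : ℝ) (m : Momentum) (x y : Space) :
    cellWave L m x * cellWave L (-m) y =
      Complex.exp (2 * Real.pi * Complex.I / L * ∑ j : Fin 3, (m j : ℂ) * ((x j - y j : ℝ) : ℂ)) := by
  rw [cellWave_apply, cellWave_apply, ← Complex.exp_add]
  congr 1
  simp only [Fin.sum_univ_three, Pi.neg_apply, Int.cast_neg]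
  push_cast
  ring

/-- **The pair kernel is the band kernel**: for `x, y` in the cell,
`Σ_{k ∈ B_M} φ_k(x) φ_{-k}(y) = L⁻³ w(x,y)`. [cite: LSSY2005, App. A (A.3), (A.5)] -/
theorem sum_planeWave_mul_planeWave_neg {L : ℝ} (hL : 0 < L) (M : ℕ) {x y : Space}
    (hx : x ∈ cell L) (hy : y ∈ cell L) :
    ∑ k ∈ momentumBand M, planeWave L k x * planeWave L (-k) y =
      ((L ^ 3)⁻¹ : ℝ) * bandKernel L M x y := by
  have hL3 : 0 < L ^ 3 := by positivity
  rw [bandKernel, Finset.mul_sum]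
  refine Finset.sum_congr rfl fun k _ => ?_
  rw [planeWave_apply_of_mem hx, planeWave_apply_of_mem hy, ← cellWave_mul_cellWave_neg]
  have h2 : ((Real.sqrt (L ^ 3) : ℝ) : ℂ)⁻¹ * ((Real.sqrt (L ^ 3) : ℝ) : ℂ)⁻¹ = ((L ^ 3)⁻¹ : ℝ) := by
    rw [← mul_inv, ← Complex.ofReal_mul, Real.mul_self_sqrt hL3.le, Complex.ofReal_inv]
  rw [← h2]; ring

/-! ### The band pair annihilation `P_B` in first quantisation -/

/-- **`P_B Ψ` in first quantisation.** For an `N = n+2`-body wave function on the cell and a finite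
set `B` of momentum labels, the `(N-2)`-body function
`(P_B Ψ)(Y) = (Σ_{k∈B} a₋ₖ aₖ Ψ)(Y) = √(N(N-1)) ∫_cell∫_cell conj(Σ_{k∈B} φ_k(x) φ_{-k}(y)) Ψ(x, y, Y) dx dy`:
(A.13) applied twice in the `L²`-normalised convention `(a(φ)Ψ)(X') = √N ∫ conj(φ(x)) Ψ(x, X') dx`
(LSSY's (A.13) reads `N ∫ … e^{-ik·x_N}` for their `V`-normalised amplitudes (A.5)); by Bose
symmetry the choice of the two contracted slots (here the first two, as in the route's
`Ψ(vecCons x (vecCons y Y))`) is immaterial. [cite: LSSY2005, App. A (A.13)] -/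
def bandPairAnnihilation (L : ℝ) (B : Finset Momentum) {n : ℕ} (Ψ : Config (n + 2) → ℂ)
    (Y : Config n) : ℂ :=
  (Real.sqrt ((n + 2) * (n + 1)) : ℂ) *
    ∫ x in cell L, ∫ y in cell L,
      conj (∑ k ∈ B, planeWave L k x * planeWave L (-k) y) * Ψ (Matrix.vecCons x (Matrix.vecCons y Y))

/-- **`P_{B_M}` through the band kernel**:
`(P_{B_M}Ψ)(Y) = √(N(N-1)) L⁻³ ∫∫ conj(w(x,y)) Ψ(x,y,Y) dx dy`. [cite: LSSY2005, App. A (A.13), (A.3)] -/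
theorem bandPairAnnihilation_momentumBand {L : ℝ} (hL : 0 < L) (M : ℕ) {n : ℕ}
    (Ψ : Config (n + 2) → ℂ) (Y : Config n) :
    bandPairAnnihilation L (momentumBand M) Ψ Y =
      (Real.sqrt ((n + 2) * (n + 1)) : ℂ) * ((L ^ 3)⁻¹ : ℝ) *
        ∫ x in cell L, ∫ y in cell L,
          conj (bandKernel L M x y) * Ψ (Matrix.vecCons x (Matrix.vecCons y Y)) := by
  rw [bandPairAnnihilation, mul_assoc]
  congr 1
  rw [← integral_const_mul]
  refine setIntegral_congr_fun (measurableSet_cell L) fun x hx => ?_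
  rw [← integral_const_mul]
  refine setIntegral_congr_fun (measurableSet_cell L) fun y hy => ?_
  rw [sum_planeWave_mul_planeWave_neg hL M hx hy, map_mul, Complex.conj_ofReal, mul_assoc]

/-- **Dictionary lemma for the anchor interaction.** For every `N = n+2`-body `Ψ` on the cell,
`(N(N-1)/2) ∫_{cell^{N-2}} |∫_cell∫_cell conj(w(x,y)) Ψ(x,y,Y) dx dy|² dY = (L⁶/2) ∫_{cell^{N-2}} |(P_{B_M}Ψ)(Y)|² dY`
(`= (L⁶/2) ⟨Ψ, P†PΨ⟩`), so the route's interaction `(γ/L⁹)·(N(N-1)/2)∫|∫∫conj(w)Ψ|²` equals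
`(γ/2L³) ‖P_{B_M}Ψ‖²`, i.e. the quartic term `(γ/2V) Σ_{k,k'∈B} a†_k a†_{-k} a_{-k'} a_{k'}` of `H_R`
(the form `(g/2) Σ A†A` of [DukelskySchuck2001, (1)] with `g = γ/V`).
[cite: LSSY2005, App. A (A.10), (A.13)] -/
theorem pairFunctional_eq {L : ℝ} (hL : 0 < L) (M : ℕ) {n : ℕ} (Ψ : Config (n + 2) → ℂ) :
    ENNReal.ofReal (((n + 2 : ℕ) : ℝ) * ((n + 2 : ℕ) - 1) / 2) *
        ∫⁻ Y in cellN n L, (‖∫ x in cell L, ∫ y in cell L,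
          conj (bandKernel L M x y) * Ψ (Matrix.vecCons x (Matrix.vecCons y Y))‖₊ : ℝ≥0∞) ^ 2 =
      ENNReal.ofReal (L ^ 6 / 2) *
        ∫⁻ Y in cellN n L, (‖bandPairAnnihilation L (momentumBand M) Ψ Y‖₊ : ℝ≥0∞) ^ 2 := by
  have hL3 : 0 < L ^ 3 := by positivity
  simp only [bandPairAnnihilation_momentumBand hL]
  have h1 : ∀ Y : Config n, ((‖(Real.sqrt ((n + 2) * (n + 1)) : ℂ) * ((L ^ 3)⁻¹ : ℝ) *
      ∫ x in cell L, ∫ y in cell L, conj (bandKernel L M x y) *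
        Ψ (Matrix.vecCons x (Matrix.vecCons y Y))‖₊ : ℝ≥0∞) ^ 2) =
      ENNReal.ofReal ((n + 2) * (n + 1) * (L ^ 3)⁻¹ ^ 2) *
        ((‖∫ x in cell L, ∫ y in cell L, conj (bandKernel L M x y) *
          Ψ (Matrix.vecCons x (Matrix.vecCons y Y))‖₊ : ℝ≥0∞) ^ 2) := by
    intro Y
    rw [nnnorm_mul, ENNReal.coe_mul, mul_pow, coe_nnnorm_sq_eq_ofReal, norm_mul, Complex.norm_real,
      Complex.norm_real, Real.norm_of_nonneg (Real.sqrt_nonneg _), Real.norm_of_nonneg (by positivity),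
      mul_pow, Real.sq_sqrt (by positivity)]
  simp only [h1]
  rw [lintegral_const_mul' _ _ ENNReal.ofReal_ne_top, ← mul_assoc, ← ENNReal.ofReal_mul (by positivity)]
  congr 2
  push_cast
  field_simp
  ring

/-! ### The torus Fock layer -/

/-- **The Fock layer of the torus**: the finite-excitation bosonic Fock space over the plane-wave
modes `φₙ`, `n ∈ ℤ³`, in the holomorphic model of layer A (`|d⟩⟩ = X^d` for an occupation function
`d : ℤ³ →₀ ℕ`; the `N`-particle sector is the homogeneous degree-`N` part). On it act
`Fock.cr n = a†ₙ`, `Fock.an n = aₙ`, `Fock.numberOp n = nₙ`, the band pair operator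
`Fock.bandPairAn (momentumBand M) = P_{B_M}`, and the `su(1,1)` generators `Fock.kPlus/kMinus/kZero n`
of the levels `{n,-n}` (`K⁺₀ = ½a†₀²`, `K⁰₀ = (2n₀+1)/4`), in terms of which
`H_R = Σ_k (k²+Δ[k≠0]) nₖ + (γ/2V) P_B† P_B` is Richardson's pairing Hamiltonian.
[cite: LSSY2005, App. A (A.7)–(A.11)] -/
abbrev TorusBoseFockLayer : Type := MvPolynomial Momentum ℂ

namespace TorusBoseFockLayer

/-- The unnormalised occupation-number vector `|d⟩⟩ = Π_n (a†ₙ)^{d n}|0⟩` of the torus Fock layer.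
[cite: LSSY2005, App. A (A.9)] -/
abbrev occVector (d : Momentum →₀ ℕ) : TorusBoseFockLayer := monomial d 1

/-- `nₖ |d⟩⟩ = d(k) |d⟩⟩`. [cite: LSSY2005, App. A (A.11)] -/
theorem numberOp_occVector (k : Momentum) (d : Momentum →₀ ℕ) :
    Fock.numberOp k (occVector d) = (d k : ℂ) • occVector d :=
  Fock.numberOp_monomial k d 1

/-- `|d⟩⟩` lies in the `N`-particle sector for `N = Σ_n d(n)`. [cite: LSSY2005, App. A (A.9), (A.11)] -/
theorem isHomogeneous_occVector (d : Momentum →₀ ℕ) :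
    (occVector d).IsHomogeneous d.degree :=
  isHomogeneous_monomial 1 rfl

/-- On the torus `k = -k` only for `k = 0`. [folklore] -/
theorem eq_neg_iff (k : Momentum) : k = -k ↔ k = 0 := by
  constructor
  · intro h
    funext j
    have hj := congrFun h j
    simp only [Pi.neg_apply] at hj
    simp only [Pi.zero_apply]
    omega
  · rintro rfl; simp

/-- For `k ≠ 0` the `su(1,1)` level of `k` is generic: `K⁺ₖ = a†ₖ a†₋ₖ`.
[cite: DukelskyPittelSierra2004, §III (KB)] -/
theorem kPlus_apply_of_ne_zero {k : Momentum} (hk : k ≠ 0) (p : TorusBoseFockLayer) :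
    Fock.kPlus k p = Fock.pairCr k p :=
  Fock.kPlus_apply_of_ne (fun h => hk ((eq_neg_iff k).mp h)) p

/-- For `k ≠ 0`: `K⁻ₖ = a₋ₖ aₖ`. [cite: DukelskyPittelSierra2004, §III (KB)] -/
theorem kMinus_apply_of_ne_zero {k : Momentum} (hk : k ≠ 0) (p : TorusBoseFockLayer) :
    Fock.kMinus k p = Fock.pairAn k p :=
  Fock.kMinus_apply_of_ne (fun h => hk ((eq_neg_iff k).mp h)) p

/-- The zero-mode generators: `K⁺₀ = ½ a†₀²`. [cite: DukelskyPittelSierra2004, §III (KB)] -/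
theorem kPlus_zero_apply (p : TorusBoseFockLayer) :
    Fock.kPlus (0 : Momentum) p = (2 : ℂ)⁻¹ • Fock.cr 0 (Fock.cr 0 p) :=
  Fock.kPlus_apply_of_eq (by simp) p

/-- `K⁰₀ = ½n₀ + ¼ = (2n₀ + 1)/4`. [cite: DukelskyPittelSierra2004, §III (KB)] -/
theorem kZero_zero_apply (p : TorusBoseFockLayer) :
    Fock.kZero (0 : Momentum) p = (2 : ℂ)⁻¹ • Fock.numberOp 0 p + (4 : ℂ)⁻¹ • p :=
  Fock.kZero_apply_of_eq (by simp) p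

/-- The band pair operator `P_{B_M} = Σ_{k∈B_M} a₋ₖaₖ` of the torus band maps the `N`-sector to the
`(N-2)`-sector. [cite: LSSY2005, App. A (A.13)] -/
theorem isHomogeneous_bandPairAn (M : ℕ) {p : TorusBoseFockLayer} {N : ℕ} (hp : p.IsHomogeneous N) :
    (Fock.bandPairAn (momentumBand M) p).IsHomogeneous (N - 2) :=
  Fock.isHomogeneous_bandPairAn _ hp

end TorusBoseFockLayer


/-! ## C. Momentum occupations of `N`-body states: slices, Parseval, kinetic energy -/

section MomentumOccupationSlices

variable {L : ℝ}

/-- The momentum amplitude of the first particle: `Y ↦ ĉ_k(x ↦ Ψ(x, Y))` is measurable for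
continuous `Ψ`. [folklore] -/
theorem measurable_cellFourierCoeff_vecCons {n : ℕ} (hL : 0 < L) (k : Momentum)
    {Ψ : Config (n + 1) → ℂ} (hΨ : Continuous Ψ) :
    Measurable fun Y : Config n => cellFourierCoeff L (fun x => Ψ (Matrix.vecCons x Y)) k := by
  have h : StronglyMeasurable (Function.uncurry fun (Y : Config n) (x : Space) =>
      conj (cellWave L k x) * Ψ (Matrix.vecCons x Y)) := by
    refine Continuous.stronglyMeasurable ?_
    refine ((Complex.continuous_conj.comp ((continuous_cellWave L k).comp continuous_snd)).mul
      (hΨ.comp ?_))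
    exact continuous_snd.matrixVecCons continuous_fst
  have h2 : StronglyMeasurable fun Y : Config n =>
      ∫ x in cell L, conj (cellWave L k x) * Ψ (Matrix.vecCons x Y) :=
    h.integral_prod_right' (ν := volume.restrict (cell L))
  simp only [cellFourierCoeff_eq_integral hL]
  exact h2.measurable.const_smul ((L ^ 3)⁻¹ : ℝ)

/-- **The momentum occupation through slices.**
`n_k(Ψ) = N · L³ ∫_{cell^{N-1}} |ĉ_k(x ↦ Ψ(x, Y))|² dY` for an `N = n+1`-body function on the cell
(unfolding `occupation` at the mode `φₙ`: `∫_cell conj(φₙ) Ψ(·,Y) = L^{3/2} ĉₙ(Ψ(·,Y))`).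
[cite: LSSY2005, App. A (A.5), (A.13)] -/
theorem momentumOccupation_succ {n : ℕ} (hL : 0 < L) (k : Momentum) (Ψ : Config (n + 1) → ℂ) :
    momentumOccupation (n + 1) L k Ψ =
      (n + 1 : ℝ≥0∞) * (ENNReal.ofReal L ^ 3 *
        ∫⁻ Y in cellN n L, (‖cellFourierCoeff L (fun x => Ψ (Matrix.vecCons x Y)) k‖₊ : ℝ≥0∞) ^ 2) := by
  have hL3 : 0 < L ^ 3 := by positivity
  have hL3' : ENNReal.ofReal L ^ 3 ≠ 0 := pow_ne_zero _ (by simpa using hL)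
  rw [momentumOccupation_eq]
  unfold occupation
  push_cast
  congr 1
  have hpt : ∀ Y : Config n,
      (‖∫ x, conj (planeWave L k x) * (cellN (n + 1) L).indicator Ψ (Matrix.vecCons x Y)‖₊ : ℝ≥0∞) ^ 2 =
        (cellN n L).indicator (fun Y => ENNReal.ofReal L ^ 3 *
          (‖cellFourierCoeff L (fun x => Ψ (Matrix.vecCons x Y)) k‖₊ : ℝ≥0∞) ^ 2) Y := by
    intro Y
    by_cases hY : Y ∈ cellN n L
    · rw [Set.indicator_of_mem hY]
      have hint : (fun x => conj (planeWave L k x) * (cellN (n + 1) L).indicator Ψ (Matrix.vecCons x Y)) =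
          (cell L).indicator (fun x => ((Real.sqrt (L ^ 3))⁻¹ : ℂ) *
            (conj (cellWave L k x) * Ψ (Matrix.vecCons x Y))) := by
        funext x
        by_cases hx : x ∈ cell L
        · have hmem : Matrix.vecCons x Y ∈ cellN (n + 1) L := by
            intro j
            refine Fin.cases ?_ (fun i => ?_) j
            · simpa using hx
            · simpa using hY i
          rw [Set.indicator_of_mem hx, Set.indicator_of_mem hmem, planeWave_apply_of_mem hx, map_mul,
            map_inv₀, Complex.conj_ofReal, mul_assoc]
        · rw [Set.indicator_of_notMem hx, planeWave_apply_of_not_mem hx, map_zero, zero_mul]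
      rw [hint, integral_indicator (measurableSet_cell L), integral_const_mul]
      have hc : ∫ x in cell L, conj (cellWave L k x) * Ψ (Matrix.vecCons x Y) =
          ((L ^ 3 : ℝ) : ℂ) * cellFourierCoeff L (fun x => Ψ (Matrix.vecCons x Y)) k := by
        rw [cellFourierCoeff_eq_integral hL, Complex.real_smul, ← mul_assoc, ← Complex.ofReal_mul,
          mul_inv_cancel₀ hL3.ne', Complex.ofReal_one, one_mul]
      rw [hc, ← mul_assoc, nnnorm_mul, ENNReal.coe_mul, mul_pow]
      congr 1
      rw [coe_nnnorm_sq_eq_ofReal, norm_mul, norm_inv, Complex.norm_real, Complex.norm_real,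
        Real.norm_of_nonneg (Real.sqrt_nonneg _), Real.norm_of_nonneg hL3.le, ← ENNReal.ofReal_pow hL.le]
      congr 1
      rw [mul_pow, inv_pow, Real.sq_sqrt hL3.le]
      field_simp
    · rw [Set.indicator_of_notMem hY]
      have hint : (fun x => conj (planeWave L k x) * (cellN (n + 1) L).indicator Ψ (Matrix.vecCons x Y)) =
          fun _ => 0 := by
        funext x
        have hmem : Matrix.vecCons x Y ∉ cellN (n + 1) L := fun h => hY fun i => by simpa using h i.succ
        rw [Set.indicator_of_notMem hmem, mul_zero]
      rw [hint]
      simp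
  simp only [hpt]
  rw [lintegral_indicator (measurableSet_cellN n L),
    lintegral_const_mul' _ _ (ENNReal.pow_ne_top ENNReal.ofReal_ne_top)]

/-- Slices `x ↦ Ψ(x, Y)` of a continuous function are continuous. [folklore] -/
theorem continuous_vecCons_slice {n : ℕ} {Ψ : Config (n + 1) → ℂ} (hΨ : Continuous Ψ) (Y : Config n) :
    Continuous fun x => Ψ (Matrix.vecCons x Y) :=
  hΨ.comp (continuous_id.matrixVecCons continuous_const)

/-- **Fubini for the first particle**: `∫_{cell^{n+1}} G(X) dX = L³ ∫_{cell^n} H(Y) dY` whenever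
`G(x, Y) = H(Y)` does not depend on the first particle. [folklore] -/
theorem lintegral_cellN_succ_of_vecCons {n : ℕ} (L : ℝ) {G : Config (n + 1) → ℝ≥0∞} {H : Config n → ℝ≥0∞}
    (hH : Measurable H) (hGH : ∀ (x : Space) (Y : Config n), G (Matrix.vecCons x Y) = H Y) :
    ∫⁻ X in cellN (n + 1) L, G X = ENNReal.ofReal L ^ 3 * ∫⁻ Y in cellN n L, H Y := by
  set μ : Fin (n + 1) → Measure Space := fun _ => volume.restrict (cell L) with hμ
  have hmp := measurePreserving_piFinSuccAbove μ 0
  rw [volume_restrict_cellN, volume_restrict_cellN, hmp.symm.lintegral_map_equiv G]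
  have hG : ∀ z : Space × Config n,
      G ((MeasurableEquiv.piFinSuccAbove (fun _ => Space) 0).symm z) = H z.2 := by
    rintro ⟨y, Y⟩
    have : (MeasurableEquiv.piFinSuccAbove (fun _ : Fin (n + 1) => Space) 0).symm (y, Y) =
        Matrix.vecCons y Y := by
      change Fin.insertNth 0 y Y = (Fin.cons y Y : Config (n + 1))
      exact Fin.insertNth_zero' y Y
    rw [this, hGH]
  simp only [hG]
  rw [lintegral_prod (fun z : Space × Config n => H z.2) (hH.comp measurable_snd).aemeasurable]
  simp only
  rw [lintegral_const, Measure.restrict_apply_univ, volume_cell, mul_comm]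

/-- **Parseval for the momentum occupations.** For a continuous `N = n+1`-body function on the cell,
`Σ_k n_k(Ψ) = N ∫_{cell^N} |Ψ|²` (one-body Parseval in the first particle, then Tonelli); for a
normalised state this is `Σ_k ⟨a†_k a_k⟩ = N`, the number operator (A.11).
[cite: LSSY2005, App. A (A.11)] -/
theorem tsum_momentumOccupation {n : ℕ} (hL : 0 < L) {Ψ : Config (n + 1) → ℂ} (hΨ : Continuous Ψ) :
    ∑' k, momentumOccupation (n + 1) L k Ψ =
      (n + 1 : ℝ≥0∞) * ∫⁻ X in cellN (n + 1) L, (‖Ψ X‖₊ : ℝ≥0∞) ^ 2 := by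
  have hL3 : ENNReal.ofReal L ^ 3 ≠ 0 := pow_ne_zero _ (by simpa using hL)
  have hL3' : ENNReal.ofReal L ^ 3 ≠ ⊤ := ENNReal.pow_ne_top ENNReal.ofReal_ne_top
  have hmeas : ∀ k : Momentum, Measurable fun Y : Config n =>
      (‖cellFourierCoeff L (fun x => Ψ (Matrix.vecCons x Y)) k‖₊ : ℝ≥0∞) ^ 2 := fun k =>
    ((measurable_cellFourierCoeff_vecCons hL k hΨ).nnnorm.coe_nnreal_ennreal).pow_const _
  simp only [momentumOccupation_succ hL]
  rw [ENNReal.tsum_mul_left, ENNReal.tsum_mul_left]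
  congr 1
  rw [← lintegral_tsum fun k => (hmeas k).aemeasurable]
  have hP : ∀ Y : Config n, ∑' k, (‖cellFourierCoeff L (fun x => Ψ (Matrix.vecCons x Y)) k‖₊ : ℝ≥0∞) ^ 2 =
      (ENNReal.ofReal L ^ 3)⁻¹ * ∫⁻ x in cell L, (‖Ψ (Matrix.vecCons x Y)‖₊ : ℝ≥0∞) ^ 2 := fun Y =>
    tsum_sq_cellFourierCoeff hL (continuous_vecCons_slice hΨ Y)
  simp only [hP]
  rw [lintegral_const_mul' _ _ (ENNReal.inv_ne_top.mpr hL3), ← mul_assoc, ENNReal.mul_inv_cancel hL3 hL3',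
    one_mul]
  -- Fubini: `∫_{cell^n} ∫_cell |Ψ(x,Y)|² dx dY = ∫_{cell^{n+1}} |Ψ|²`
  have hslice := lintegral_cellN_succ_of_vecCons L (n := n)
    (G := fun X => ∫⁻ x in cell L, (‖Ψ (Function.update X 0 x)‖₊ : ℝ≥0∞) ^ 2)
    (H := fun Y => ∫⁻ x in cell L, (‖Ψ (Matrix.vecCons x Y)‖₊ : ℝ≥0∞) ^ 2) ?_ ?_
  · rw [← ENNReal.mul_right_inj hL3 hL3', ← hslice,
      lintegral_normSq_slice 0 hΨ.measurable]
  · -- measurability of `Y ↦ ∫_cell |Ψ(x,Y)|² dx`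
    have h : Measurable (Function.uncurry fun (Y : Config n) (x : Space) =>
        (‖Ψ (Matrix.vecCons x Y)‖₊ : ℝ≥0∞) ^ 2) :=
      ((hΨ.comp (continuous_snd.matrixVecCons continuous_fst)).measurable.nnnorm.coe_nnreal_ennreal).pow_const _
    exact h.lintegral_prod_right'
  · intro x Y
    simp only [Matrix.vecCons, Fin.update_cons_zero]

/-- **`Σ_k n_k = N` for a periodic trial state** (`‖Ψ‖ = 1` on the cell). [cite: LSSY2005, App. A (A.11)] -/
theorem tsum_momentumOccupation_trialState {N : ℕ} (hL : 0 < L) (Ψ : PeriodicTrialState N L) :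
    ∑' k, momentumOccupation N L k Ψ.ψ = N := by
  cases N with
  | zero => simp [momentumOccupation_eq, occupation]
  | succ n =>
    rw [tsum_momentumOccupation hL Ψ.contDiff.continuous, Ψ.norm_eq, mul_one]
    norm_num

/-- **The depletion is the excited occupation**: `N - ⟨Ψ, n₀Ψ⟩ = Σ_{k ≠ 0} n_k(Ψ)` for a periodic
trial state (the route's penalty term `2ργ(N - condensateOccupation)` is `2ργ Σ_{k≠0} ⟨a†_k a_k⟩`, the
exchange shift `Δ = 2ργ` on the excited modes). [cite: Fournais2020, (1.5)] -/
theorem natCast_sub_condensateOccupation {N : ℕ} (hL : 0 < L) (Ψ : PeriodicTrialState N L) :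
    (N : ℝ≥0∞) - condensateOccupation N L Ψ.ψ =
      ∑' k, if k = 0 then 0 else momentumOccupation N L k Ψ.ψ := by
  have h := tsum_momentumOccupation_trialState hL Ψ
  rw [ENNReal.tsum_eq_add_tsum_ite (0 : Momentum), momentumOccupation_zero] at h
  have hfin : condensateOccupation N L Ψ.ψ ≠ ⊤ := by
    intro htop
    rw [htop, top_add] at h
    exact ENNReal.natCast_ne_top N h.symm
  rw [← h, ENNReal.add_sub_cancel_left hfin]
  refine tsum_congr fun k => ?_
  split_ifs <;> rfl

end MomentumOccupationSlices

section Kinetic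

variable {L : ℝ}

/-- The kinetic weight `|k|²` of the mode `n` in `ℝ≥0∞`, matching `tsum_sq_grad_cellFourierCoeff`.
[cite: LSSY2005, App. A (A.6)] -/
theorem ofReal_norm_waveVector_sq (L : ℝ) (k : Momentum) :
    ENNReal.ofReal (‖waveVector L k‖ ^ 2) =
      ENNReal.ofReal (4 * Real.pi ^ 2 * (∑ j, (k j : ℝ) ^ 2) / L ^ 2) := by
  rw [norm_waveVector_sq]

/-- The spectral kinetic density of the first particle, `Y ↦ Σ_k |k|² |ĉ_k(Ψ(·,Y))|²`, is measurable.
[folklore] -/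
theorem measurable_tsum_sq_grad_vecCons {n : ℕ} (hL : 0 < L) {Ψ : Config (n + 1) → ℂ} (hΨ : Continuous Ψ) :
    Measurable fun Y : Config n => ∑' k : Momentum, ENNReal.ofReal (‖waveVector L k‖ ^ 2) *
      (‖cellFourierCoeff L (fun x => Ψ (Matrix.vecCons x Y)) k‖₊ : ℝ≥0∞) ^ 2 :=
  Measurable.tsum fun k =>
    (((measurable_cellFourierCoeff_vecCons hL k hΨ).nnnorm.coe_nnreal_ennreal).pow_const _).const_mul _

/-- **The kinetic energy is diagonal in momentum**: for a periodic `C¹` Bose-symmetric `N`-body state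
on the torus, `∫_{cell^N} |∇Ψ|² = Σ_k |k|² n_k(Ψ)`, i.e. `⟨Ψ, Σᵢ(-Δᵢ)Ψ⟩ = Σ_k ε(k) ⟨a†_k a_k⟩` with
`ε(k) = k²` (A.6), (A.10) (one-body Parseval for gradients in each particle, Bose symmetry, Tonelli).
[cite: LSSY2005, App. A (A.6), (A.10)] -/
theorem tsum_normSq_waveVector_mul_momentumOccupation {N : ℕ} (hL : 0 < L) (Ψ : PeriodicTrialState N L) :
    ∑' k, ENNReal.ofReal (‖waveVector L k‖ ^ 2) * momentumOccupation N L k Ψ.ψ =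
      ∫⁻ X in cellN N L, kineticDensity Ψ.ψ X := by
  cases N with
  | zero =>
    simp [momentumOccupation_eq, occupation, kineticDensity]
  | succ n =>
    have hL3 : ENNReal.ofReal L ^ 3 ≠ 0 := pow_ne_zero _ (by simpa using hL)
    have hL3' : ENNReal.ofReal L ^ 3 ≠ ⊤ := ENNReal.pow_ne_top ENNReal.ofReal_ne_top
    have hcont : Continuous Ψ.ψ := Ψ.contDiff.continuous
    -- the spectral kinetic density of the first particle
    set S : Config n → ℝ≥0∞ := fun Y => ∑' k : Momentum, ENNReal.ofReal (‖waveVector L k‖ ^ 2) *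
      (‖cellFourierCoeff L (fun x => Ψ.ψ (Matrix.vecCons x Y)) k‖₊ : ℝ≥0∞) ^ 2 with hS
    have hSm : Measurable S := measurable_tsum_sq_grad_vecCons hL hcont
    -- Step 1: the momentum sum through slices
    have hlhs : ∑' k, ENNReal.ofReal (‖waveVector L k‖ ^ 2) * momentumOccupation (n + 1) L k Ψ.ψ =
        (n + 1 : ℝ≥0∞) * (ENNReal.ofReal L ^ 3 * ∫⁻ Y in cellN n L, S Y) := by
      have hg : ∀ k : Momentum, Measurable fun Y : Config n =>
          (‖cellFourierCoeff L (fun x => Ψ.ψ (Matrix.vecCons x Y)) k‖₊ : ℝ≥0∞) ^ 2 := fun k =>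
        ((measurable_cellFourierCoeff_vecCons hL k hcont).nnnorm.coe_nnreal_ennreal).pow_const _
      simp only [momentumOccupation_succ hL, hS]
      rw [lintegral_tsum fun k => ((hg k).const_mul _).aemeasurable, ← ENNReal.tsum_mul_left,
        ← ENNReal.tsum_mul_left]
      refine tsum_congr fun k => ?_
      rw [lintegral_const_mul _ (hg k)]
      ring
    -- Step 2: each particle's kinetic energy is `L³ ∫ S`
    have hslice0 : ∀ X : Config (n + 1), ∫⁻ x in cell L, gradSqC (fun y => Ψ.ψ (Function.update X 0 y)) x =
        ENNReal.ofReal L ^ 3 * ∑' k : Momentum, ENNReal.ofReal (‖waveVector L k‖ ^ 2) *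
          (‖cellFourierCoeff L (fun y => Ψ.ψ (Function.update X 0 y)) k‖₊ : ℝ≥0∞) ^ 2 := by
      intro X
      have h := tsum_sq_grad_cellFourierCoeff hL (Ψ.contDiff_slice X 0) (fun x k => Ψ.periodic_slice X 0 x k)
      simp only [ofReal_norm_waveVector_sq]
      rw [h, ← mul_assoc, ENNReal.mul_inv_cancel hL3 hL3', one_mul]
      rfl
    have hterm : ∀ i : Fin (n + 1), (ENNReal.ofReal L ^ 3)⁻¹ *
        ∫⁻ X in cellN (n + 1) L, ∫⁻ x in cell L, gradSqC (fun y => Ψ.ψ (Function.update X i y)) x =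
          ENNReal.ofReal L ^ 3 * ∫⁻ Y in cellN n L, S Y := by
      intro i
      -- Bose symmetry: slice `i` of `X` is slice `0` of `X ∘ swap 0 i`
      have h1 : (fun X => ∫⁻ x in cell L, gradSqC (fun y => Ψ.ψ (Function.update X i y)) x) =
          fun X => (fun Z => ∫⁻ x in cell L, gradSqC (fun y => Ψ.ψ (Function.update Z 0 y)) x) (X ∘ Equiv.swap 0 i) := by
        funext X
        have : (fun y => Ψ.ψ (Function.update X i y)) = fun y => Ψ.ψ (Function.update (X ∘ Equiv.swap 0 i) 0 y) :=
          funext fun y => by rw [← Ψ.symm (Equiv.swap 0 i) (Function.update X i y), update_comp_swap]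
        rw [this]
      rw [h1, lintegral_cellN_comp_perm (Equiv.swap 0 i)
        (fun Z => ∫⁻ x in cell L, gradSqC (fun y => Ψ.ψ (Function.update Z 0 y)) x)]
      simp only [hslice0]
      rw [lintegral_cellN_succ_of_vecCons L (H := fun Y => ENNReal.ofReal L ^ 3 * S Y) (hSm.const_mul _) ?_,
        lintegral_const_mul _ hSm, ← mul_assoc, ← mul_assoc, ENNReal.inv_mul_cancel hL3 hL3', one_mul]
      intro x Y
      simp only [hS, Matrix.vecCons, Fin.update_cons_zero]
    rw [hlhs, ← sum_lintegral_gradSqC_slice hL (Ψ.contDiff.differentiable one_ne_zero)]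
    simp only [hterm, Finset.sum_const, Finset.card_univ, Fintype.card_fin, nsmul_eq_mul]
    push_cast
    ring

/-- `v = 0` has no periodised interaction. [folklore] -/
theorem periodicInteraction_zero {N : ℕ} (L : ℝ) (X : Config N) : periodicInteraction 0 L X = 0 := by
  simp [periodicInteraction, periodizedPotential]

/-- **The free periodic energy in momentum space**: `periodicEnergy 0 Ψ = Σ_k |k|² n_k(Ψ)` — the kinetic
term `Σ_k k² a†_k a_k` of `H_R`. [cite: LSSY2005, App. A (A.10)] -/
theorem periodicEnergy_zero_eq_tsum {N : ℕ} (hL : 0 < L) (Ψ : PeriodicTrialState N L) :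
    periodicEnergy 0 Ψ = ∑' k, ENNReal.ofReal (‖waveVector L k‖ ^ 2) * momentumOccupation N L k Ψ.ψ := by
  rw [tsum_normSq_waveVector_mul_momentumOccupation hL, periodicEnergy]
  refine lintegral_congr fun X => ?_
  rw [periodicInteraction_zero, zero_mul, add_zero]

end Kinetic

end Literature.MathematicalPhysics.QuantumManyBody.BoseGas

end
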